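import Summits.HodgeConjecture.HodgeCM.PerL34.GodementCompact_1

/-! PORT of `HodgeCM/PerL34/GodementCompact.lean` (HodgeCMPerL run 82) — part 2: continuation of `Summits.HodgeConjecture.HodgeCM.PerL34.GodementCompact_1` (split at a top-level declaration boundary by port_pkg.py; scope re-opened below; declarations unchanged). -/

-- port_pkg: scope re-opened for this part (file-level context, then the namespace/section stack open at the cut)
noncomputable section
open scoped NNReal Matrix Pointwise MatrixGroups
open NumberField IsDedekindDomain
namespace HodgeCM.PerL34.Godement
open Literature.NumberTheory Literature.NumberTheory.Automorphic
open Literature.AlgebraicGeometry.ShimuraVarieties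
open HodgeCM.Adelic HodgeCM.PerL34.StabilizerDescent
section CMField
variable (L : Type) [Field L] [NumberField L] [IsCMField L]
variable {n : Type} [Fintype n] [DecidableEq n]
local notation "𝔸L" => AdeleRing (𝓞 L) L
omit [IsCMField L] in
/-- `toAdeleGL` is `GL_n` of the diagonal embedding (definitional). -/
theorem toAdeleGL_eq_map (g : GL n L) :
    toAdeleGL L g = Matrix.GeneralLinearGroup.map (algebraMap L 𝔸L) g :=
  Units.ext rfl

omit [Fintype n] [DecidableEq n] in
/-- Conjugating the base change of a rational matrix: `c(g_𝔸) = (c g)_𝔸`. -/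
theorem map_map_adeleConj (g : Matrix n n L) :
    (g.map (algebraMap L 𝔸L)).map (adeleConj L) = (g.map (conjRingHomK L)).map (algebraMap L 𝔸L) := by
  rw [Matrix.map_map, Matrix.map_map]
  exact congrArg _ (funext fun x => adeleConj_algebraMap L x)

/-- `H_𝔸 · γ ∈ M_n(L)` for rational `γ`. -/
theorem conjAct_toAdeleGL_mem (H : Matrix n n L) (g : GL n L) :
    (conjAct L).act (H.map (algebraMap L 𝔸L)) (toAdeleGL L g) ∈ principalMatrices L (n := n) := by
  have hact : (conjAct L).act (H.map (algebraMap L 𝔸L)) (toAdeleGL L g) =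
      ((((g : Matrix n n L).map (conjRingHomK L))ᵀ * H) * (g : Matrix n n L)).map (algebraMap L 𝔸L) := by
    rw [conjAct_act, val_toAdeleGL, map_map_adeleConj, ← Matrix.transpose_map, ← Matrix.map_mul,
      ← Matrix.map_mul]
  intro i j
  rw [hact]
  exact ⟨_, rfl⟩

/-- **`U(H)(𝔸) ∩ GL_n(L) = U(H)(L⁺)`**: an adelic unitary matrix with rational entries is a
rational unitary matrix (entrywise injectivity of `L → 𝔸_L`). -/
theorem mem_adelicUnitaryRat_of_eq_toAdeleGL (H : Matrix n n L) {γ : GL n 𝔸L}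
    (hγU : γ ∈ adelicUnitaryGroup L H) {g : GL n L} (hg : toAdeleGL L g = γ) :
    (⟨γ, hγU⟩ : adelicUnitaryGroup L H) ∈ adelicUnitaryRat L H := by
  rw [mem_adelicUnitaryRat_iff]
  refine ⟨g, ?_, hg⟩
  rw [mem_unitaryGroup_iff]
  have hγ := (mem_adelicUnitaryGroup_iff L H γ).mp hγU
  rw [← hg, val_toAdeleGL, map_map_adeleConj, ← Matrix.transpose_map, ← Matrix.map_mul,
    ← Matrix.map_mul] at hγ
  exact Matrix.map_injective (algebraMap L 𝔸L).injective hγ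

/-! ## §6 Compactness of `U(H)(L⁺)\U(H)(𝔸_{L⁺})` -/

/-- **Godement's compactness criterion for anisotropic unitary groups (KERNEL).**  For a CM field
`L`, `H ∈ M_k(L)` and the CM conjugation `c`, if `⟪x, x⟫_H = (c x)ᵀ H x = 0 ⇒ x = 0` on `Lᵏ`, then
`U(H)(L⁺)\U(H)(𝔸_{L⁺})` is compact (Borel–Harish-Chandra 1962 / Mostow–Tamagawa 1962 /
Godement, Sém. Bourbaki 257, Thm. 4.2, for the anisotropic group `U(H)`; Margulis 1991, Ch. I
Thm. 3.2.1(b)). -/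
theorem compactSpace_adelicUnitaryQuot {k : ℕ} (H : Matrix (Fin k) (Fin k) L)
    (hanis : ∀ x : Fin k → L, hermForm (conjRingHomK L) H x x = 0 → x = 0) :
    CompactSpace (adelicUnitaryGroup L H ⧸ adelicUnitaryRat L H) := by
  obtain ⟨c, hc, hfloor⟩ := exists_vecHeight_floor L H hanis
  have hdet : H.det ≠ 0 := det_ne_zero_of_anisotropic L H hanis
  -- Mahler: `U(H)(𝔸) ⊆ C · GL_k(L)`
  obtain ⟨C, hC, hCmul⟩ := Mahler.exists_isCompact_mul_rational k L c 1 hc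
  have hUΓ : ∀ g ∈ adelicUnitaryGroup L H,
      g ∈ C * (rationalPointsGL k L : Set (GL (Fin k) 𝔸L)) := fun g hg =>
    hCmul g (hfloor g hg) (ideleNorm_det_eq_one L H hdet hg).le
  -- descent: `U(H)(𝔸) ⊆ C' · (U(H)(𝔸) ∩ GL_k(L))`, `C' ⊆ U(H)(𝔸)` compact
  have hstab := stabilizer_conjAct L H
  obtain ⟨C', hC', hC'U, hdesc⟩ := (conjAct L).exists_isCompact_descent (H.map (algebraMap L 𝔸L))
    (continuous_conjAct L _) (by rw [hstab]; exact isClosed_adelicUnitaryGroup L H)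
    (rationalPointsGL k L) (principalMatrices L)
    (fun γ hγ => by
      obtain ⟨g, rfl⟩ := MonoidHom.mem_range.mp hγ
      rw [← toAdeleGL_eq_map]
      exact conjAct_toAdeleGL_mem L H g)
    (fun K hK => finite_inter_principalMatrices L hK) hC
  rw [hstab] at hC'U hdesc
  -- the compact set `C' ∩ U(H)(𝔸)` of the subtype surjects onto the quotient
  have hemb : Topology.IsClosedEmbedding
      (Subtype.val : adelicUnitaryGroup L H → GL (Fin k) 𝔸L) :=
    (isClosed_adelicUnitaryGroup L H).isClosedEmbedding_subtypeVal
  have hK : IsCompact (Subtype.val ⁻¹' C' : Set (adelicUnitaryGroup L H)) :=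
    hemb.isCompact_preimage hC'
  have himg : (QuotientGroup.mk : adelicUnitaryGroup L H → adelicUnitaryGroup L H ⧸ adelicUnitaryRat L H) ''
      (Subtype.val ⁻¹' C') = Set.univ := by
    refine Set.eq_univ_of_forall fun x => ?_
    induction x using QuotientGroup.induction_on with
    | H u =>
      obtain ⟨c', hc', γ, ⟨hγU, hγΓ⟩, hcγ⟩ := Set.mem_mul.mp (hdesc u u.2 (hUΓ u u.2))
      obtain ⟨g, hg⟩ := MonoidHom.mem_range.mp hγΓ
      rw [← toAdeleGL_eq_map] at hg
      refine ⟨⟨c', hC'U hc'⟩, hc', ?_⟩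
      apply QuotientGroup.eq.mpr
      have hγeq : (⟨c', hC'U hc'⟩ : adelicUnitaryGroup L H)⁻¹ * u = ⟨γ, hγU⟩ := by
        apply Subtype.ext
        change c'⁻¹ * (u : GL (Fin k) 𝔸L) = γ
        rw [← hcγ, inv_mul_cancel_left]
      rw [hγeq]
      exact mem_adelicUnitaryRat_of_eq_toAdeleGL L H hγU hg
  refine ⟨?_⟩
  rw [← himg]
  exact hK.image QuotientGroup.continuous_mk

end CMField

end HodgeCM.PerL34.Godement

/-- **`HodgeCM.PrintFact_unitaryCompact` is a theorem**: for every CM field `L`, every `n` and every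
hermitian anisotropic `H ∈ M_n(L)`, the adelic quotient `U(H)(L⁺)\U(H)(𝔸_{L⁺})` is compact
(kernel-checked: Minkowski reduction ⇒ Mahler's criterion ⇒ Godement's criterion; the
hermitian hypothesis is not even used). -/
theorem HodgeCM.printFact_unitaryCompact_holds : HodgeCM.PrintFact_unitaryCompact :=
  fun L _ H _ hanis => HodgeCM.PerL34.Godement.compactSpace_adelicUnitaryQuot (L := L) H hanis

end
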